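/-
Copyright (c) 2026. All rights reserved.
Released under Apache 2.0 license as described in the file LICENSE.
-/
import Mathlib
import HarnessLib
import Literature.MathematicalPhysics.QuantumLattice.AbelianFieldTensor
import Literature.MathematicalPhysics.QuantumLattice.AbelianMagneticFlux
import Summits.Ventures.LatticeQCDFlow.Scaling.FluxSectorCollar
import Summits.Ventures.LatticeQCDFlow.Scaling.BoxSpreadWitness
import Summits.Ventures.LatticeQCDFlow.Scaling.FluxInsertionBox
import Summits.Ventures.LatticeQCDFlow.Scaling.FluxInsertionHeightLaw
import Summits.Ventures.LatticeQCDFlow.Scaling.TorusPotential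
import Summits.Ventures.LatticeQCDFlow.Scaling.FluxInsertionHeightCeiling
import Summits.Ventures.LatticeQCDFlow.Scaling.SectorActionFloor
import Summits.Ventures.LatticeQCDFlow.Scaling.FluxInsertionMountainPass
import Summits.Ventures.LatticeQCDFlow.Scaling.FluxInsertionBlockPasses

/-!
# The VALUE of the min–max height of the block flux-insertion kernel — conjecture C9″b of
THEORY-2.md DECIDED: true up to half the torus, false beyond (lean-1 GEN-6, own work)

HONEST FRAMING: exact (Metropolis-corrected) sampling algorithms for lattice gauge theory;
figures of merit are autocorrelation/cost numbers at stated couplings and volumes; no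
continuum-physics claim.

Venture `LatticeQCDFlow` (cell pub-lqcd), topic `Scaling`, FANOUT row 30 (lean-1).  NEW WORK of the
cell; nothing here is cited as a fact.  Setting of items 106b/107b (theory2): `d = 2`, compact
`U(1)`, torus `(ℤ/L)²`, the two-sided Metropolis flux-insertion kernel of the `l`-block spread
`W = boxSpread l` (`2 ≤ l`, `l + 1 ≤ L`), `N = (l+1)² − 4`, `M = L² − N`, `α_l = 2π/N`, and
`E(l,L) = (boxHeight l L).toReal`, the essential min–max height `min_{X = W^{±1}} ess inf_{Haar |
Q(XU) ≠ Q(U)} max(S(U), S(XU))`, which IS the fixed-volume `β → ∞` rate of the kernel's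
tunnelling probability (item 106b, `u1_boxInsertion_height_law`).  Write
`E* = N(1 − cos(π/N)) + M(1 − cos(π/M))` (item 107b: `E(l,L) ≤ E*`, every parity) and
`S₁ = L²(1 − cos(2π/L²))` (the action of one evenly spread unit of flux).

**Results (every parity of `L`).**
* `boxHeight_ge_sharp`, `boxHeight_eq_sharp`: `2N ≤ L² ⇒ E(l,L) = E*` — **C9″b HOLDS for blocks
  up to half the torus** (from the pointwise mountain-pass inequality of
  `FluxInsertionMountainPass` / `FluxInsertionBlockPasses`; no parity hypothesis, whereas item
  106b's lower bound `N(1 − cos(π/N))` needed `L` even).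
* `boxHeight_ge_sectorFloor`: `E(l,L) ≥ S₁` always.
* `boxHeight_le_sectorFloor`, `boxHeight_eq_sectorFloor`: `L² ≤ 2N ⇒ E(l,L) = S₁` (the witness
  `U₀ = potField(2π/L² − boxF)` of `FluxInsertionBlockPasses`); and
  `boxHeight_lt_sharp`: `L² < 2N ⇒ E(l,L) < E*` — **C9″b FAILS for blocks covering more than half
  the torus** (e.g. `L = l + 1` for every `l ≥ 2`, `boxHeight_lt_sharp_minVolume`): there the
  pass is the evenly spread instanton, not the half-way configuration
  (`sectorFloor_lt_sharpValue`, strict tangent bound at `2π/L²`).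
* `boxHeight_eq_sharp_iff`: C9″b ⟺ `2N ≤ L²`; `boxHeight_toReal_eq_ite` (the two-regime closed form
  for EVERY admissible `(l, L)`, including `(2, 3)`); the fixed-volume SHARP RATES with the true constants
  (`u1_boxInsertion_fixedVolume_rate_sharp`, `u1_boxInsertion_fixedVolume_rate_sectorFloor`).
No `def`.
-/

noncomputable section

open MeasureTheory Filter Topology Real Set
open scoped ENNReal
open Literature.MathematicalPhysics.QuantumFieldTheory Literature.MathematicalPhysics.QuantumLattice
open Summit.Ventures.LatticeQCDFlow.Exactness

namespace Summit.Ventures.LatticeQCDFlow.Theory2.Lattice.Flux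

/-! ## §1 From pointwise bounds to the essential heights -/

section Heights

variable {d L : ℕ} [NeZero L]

/-- A pointwise lower bound on the charge-changing set bounds the essential height. [folklore] -/
theorem le_insHeight_of_forall (X : GaugeConfig d L Circle) (x₀ : Site d L) (μ' ν' : Fin d)
    {c : ℝ} (h : ∀ U : GaugeConfig d L Circle,
      topCharge x₀ μ' ν' (X * U) ≠ topCharge x₀ μ' ν' U →
        c ≤ max (wilsonAction u1Rep U) (wilsonAction u1Rep (X * U))) :
    ENNReal.ofReal c ≤ insHeight X x₀ μ' ν' := by
  unfold insHeight essHeight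
  refine le_essInf_of_ae_le _ ?_
  rw [Filter.EventuallyLE, ae_restrict_iff' (measurableSet_chargeNe_mul (measurable_topCharge x₀ μ' ν') X)]
  exact ae_of_all _ fun U hU => ENNReal.ofReal_le_ofReal (h U hU)

/-- The same bound transfers to the inverse insertion (substitute `U = X U'`). [folklore] -/
theorem le_insHeight_inv_of_forall (X : GaugeConfig d L Circle) (x₀ : Site d L) (μ' ν' : Fin d)
    {c : ℝ} (h : ∀ U : GaugeConfig d L Circle,
      topCharge x₀ μ' ν' (X * U) ≠ topCharge x₀ μ' ν' U →
        c ≤ max (wilsonAction u1Rep U) (wilsonAction u1Rep (X * U))) :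
    ENNReal.ofReal c ≤ insHeight X⁻¹ x₀ μ' ν' := by
  refine le_insHeight_of_forall X⁻¹ x₀ μ' ν' fun U hU => ?_
  have h' := h (X⁻¹ * U) (by rw [mul_inv_cancel_left]; exact hU.symm)
  rwa [mul_inv_cancel_left, max_comm] at h'

/-- A pointwise bound for `X = W` bounds the two-sided height `insHeight₂ W`. [folklore] -/
theorem le_insHeight₂_of_forall (W : GaugeConfig d L Circle) (x₀ : Site d L) (μ' ν' : Fin d)
    {c : ℝ} (h : ∀ U : GaugeConfig d L Circle,
      topCharge x₀ μ' ν' (W * U) ≠ topCharge x₀ μ' ν' U →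
        c ≤ max (wilsonAction u1Rep U) (wilsonAction u1Rep (W * U))) :
    ENNReal.ofReal c ≤ insHeight₂ W x₀ μ' ν' :=
  le_min (le_insHeight_of_forall W x₀ μ' ν' h) (le_insHeight_inv_of_forall W x₀ μ' ν' h)

end Heights

/-! ## §2 The value of the height and the fixed-volume sharp rates -/

section Value

variable {L : ℕ} [NeZero L] {l : ℕ}

/-- **C9″b HOLDS UP TO HALF THE TORUS** (`2 ≤ l`, `l + 1 ≤ L`, `2N ≤ L²`, every parity):
`E(l,L) ≥ N(1 − cos(π/N)) + M(1 − cos(π/M))`. [folklore] -/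
theorem boxHeight_ge_sharp (hl : 2 ≤ l) (hlL : l + 1 ≤ L)
    (hNM : 2 * ((l + 1) * (l + 1) - 4) ≤ L ^ 2) :
    (((l + 1) * (l + 1) - 4 : ℕ) : ℝ) * (1 - Real.cos (boxAlpha l / 2)) +
        ((L ^ 2 - ((l + 1) * (l + 1) - 4) : ℕ) : ℝ) *
          (1 - Real.cos (π / ((L ^ 2 - ((l + 1) * (l + 1) - 4) : ℕ) : ℝ))) ≤
      (boxHeight l L).toReal :=
  (ENNReal.ofReal_le_iff_le_toReal (boxHeight_ne_top hl hlL)).mp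
    (le_insHeight₂_of_forall _ _ _ _ fun U hU => sharpValue_le_max_wilsonAction hl hlL hNM U hU)

/-- **THE VALUE OF THE HEIGHT UP TO HALF THE TORUS**: `2N ≤ L² ⇒ E(l,L) = N(1 − cos(π/N)) +
M(1 − cos(π/M))` (conjecture C9″b of THEORY-2.md §4, every parity of `L`). [folklore] -/
theorem boxHeight_eq_sharp (hl : 2 ≤ l) (hlL : l + 1 ≤ L)
    (hNM : 2 * ((l + 1) * (l + 1) - 4) ≤ L ^ 2) :
    (boxHeight l L).toReal =
      (((l + 1) * (l + 1) - 4 : ℕ) : ℝ) * (1 - Real.cos (boxAlpha l / 2)) +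
        ((L ^ 2 - ((l + 1) * (l + 1) - 4) : ℕ) : ℝ) *
          (1 - Real.cos (π / ((L ^ 2 - ((l + 1) * (l + 1) - 4) : ℕ) : ℝ))) :=
  le_antisymm (boxHeight_le_sharp hl hlL) (boxHeight_ge_sharp hl hlL hNM)

/-- **The sector floor on the height** (every regime and parity): `E(l,L) ≥ L²(1 − cos(2π/L²))`.
[folklore] -/
theorem boxHeight_ge_sectorFloor (hl : 2 ≤ l) (hlL : l + 1 ≤ L) :
    (L : ℝ) ^ 2 * (1 - Real.cos (2 * π / (L : ℝ) ^ 2)) ≤ (boxHeight l L).toReal :=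
  (ENNReal.ofReal_le_iff_le_toReal (boxHeight_ne_top hl hlL)).mp
    (le_insHeight₂_of_forall _ _ _ _ fun U hU =>
      sectorFloor_le_max_wilsonAction (by omega) _ U hU)

/-- Beyond half the torus, real form: `L² ≤ 2N ⇒ E(l,L) ≤ L²(1 − cos(2π/L²))`. [folklore] -/
theorem boxHeight_le_sectorFloor (hl : 2 ≤ l) (hlL : l + 1 ≤ L)
    (hMN : L ^ 2 ≤ 2 * ((l + 1) * (l + 1) - 4)) :
    (boxHeight l L).toReal ≤ (L : ℝ) ^ 2 * (1 - Real.cos (2 * π / (L : ℝ) ^ 2)) :=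
  ENNReal.toReal_le_of_le_ofReal
    (mul_nonneg (sq_nonneg _) (sub_nonneg.mpr (Real.cos_le_one _)))
    (boxHeight_le_sectorFloor_ennreal hl hlL hMN)

/-- **THE VALUE OF THE HEIGHT BEYOND HALF THE TORUS**: `L² ≤ 2N ⇒ E(l,L) = L²(1 − cos(2π/L²))`.
[folklore] -/
theorem boxHeight_eq_sectorFloor (hl : 2 ≤ l) (hlL : l + 1 ≤ L)
    (hMN : L ^ 2 ≤ 2 * ((l + 1) * (l + 1) - 4)) :
    (boxHeight l L).toReal = (L : ℝ) ^ 2 * (1 - Real.cos (2 * π / (L : ℝ) ^ 2)) :=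
  le_antisymm (boxHeight_le_sectorFloor hl hlL hMN) (boxHeight_ge_sectorFloor hl hlL)

omit [NeZero L] in
/-- **The sector floor is strictly below the conjectured value beyond half the torus**:
`L² < 2N ⇒ L²(1 − cos(2π/L²)) < N(1 − cos(π/N)) + M(1 − cos(π/M))` (strict tangent bound at
`2π/L²`, using `Nπ/N + Mπ/M = 2π = L²·2π/L²`). [folklore] -/
theorem sectorFloor_lt_sharpValue (hl : 2 ≤ l) (hlL : l + 1 ≤ L)
    (hMN : L ^ 2 < 2 * ((l + 1) * (l + 1) - 4)) :
    (L : ℝ) ^ 2 * (1 - Real.cos (2 * π / (L : ℝ) ^ 2)) <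
      (((l + 1) * (l + 1) - 4 : ℕ) : ℝ) * (1 - Real.cos (boxAlpha l / 2)) +
        ((L ^ 2 - ((l + 1) * (l + 1) - 4) : ℕ) : ℝ) *
          (1 - Real.cos (π / ((L ^ 2 - ((l + 1) * (l + 1) - 4) : ℕ) : ℝ))) := by
  set n : ℝ := (((l + 1) * (l + 1) - 4 : ℕ) : ℝ) with hn
  set m : ℝ := ((L ^ 2 - ((l + 1) * (l + 1) - 4) : ℕ) : ℝ) with hm
  set θ : ℝ := 2 * π / (L : ℝ) ^ 2 with hθ
  have hL3 : (3 : ℝ) ≤ L := by exact_mod_cast (show 3 ≤ L by omega)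
  have h9 : (9 : ℝ) ≤ (L : ℝ) ^ 2 := by nlinarith
  have hn5 : 5 ≤ n := five_le_boxN_real hl
  have hm4 : 4 ≤ m := by rw [hm]; exact_mod_cast four_le_boxM hl hlL
  have hmL : m = (L : ℝ) ^ 2 - n := by rw [hm, natCast_boxM hl hlL, hn, natCast_boxN hl]
  have hlt : (L : ℝ) ^ 2 < 2 * n := by
    have : ((L ^ 2 : ℕ) : ℝ) < ((2 * ((l + 1) * (l + 1) - 4) : ℕ) : ℝ) := by exact_mod_cast hMN
    push_cast at this; rw [hn]; exact this
  have hα2 : boxAlpha l / 2 = π / n := by rw [boxAlpha_eq_div hl]; ring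
  have hθ0 : 0 ≤ θ := by positivity
  have hθ7 : θ ≤ 7 / 10 := two_pi_div_sq_le (by omega)
  -- tangent at `θ` for `φ = π/n` (weak) and `φ = π/m` (strict: `θ < π/m ≤ π − θ`)
  have hw := tangent_le_one_sub_cos hθ0 hθ7 (φ := π / n)
    (by rw [div_le_iff₀ (by linarith)]; nlinarith [Real.pi_pos])
  have hL2 : (0 : ℝ) < (L : ℝ) ^ 2 := by positivity
  have hm0 : 0 < m := by linarith
  have hθm : θ < π / m := by
    rw [lt_div_iff₀ hm0, hθ, div_mul_eq_mul_div, div_lt_iff₀ hL2]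
    nlinarith [Real.pi_pos]
  have hmπ : π / m ≤ π - θ := by
    have h1 : π / m ≤ π / 4 := div_le_div_of_nonneg_left Real.pi_pos.le (by norm_num) hm4
    have h2 : θ ≤ 2 * π / 9 := div_le_div_of_nonneg_left (by positivity) (by norm_num) h9
    nlinarith [Real.pi_pos]
  have hs := tangent_lt_one_sub_cos hθ0 hθm hmπ
  have hn0 : 0 < n := by linarith
  have hnm : n + m = (L : ℝ) ^ 2 := by rw [hmL]; ring
  have hsum : n * (π / n - θ) + m * (π / m - θ) = 0 := by
    have e1 : n * (π / n - θ) + m * (π / m - θ) = 2 * π - (n + m) * θ := by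
      field_simp
      ring
    rw [e1, hnm, hθ]
    field_simp
    ring
  rw [hα2]
  have key : (L : ℝ) ^ 2 * (1 - Real.cos θ) =
      n * ((1 - Real.cos θ) + Real.sin θ * (π / n - θ)) +
        m * ((1 - Real.cos θ) + Real.sin θ * (π / m - θ)) := by
    rw [← hnm]
    linear_combination (-Real.sin θ) * hsum
  rw [key]
  have f1 := mul_le_mul_of_nonneg_left hw hn0.le
  have f2 := mul_lt_mul_of_pos_left hs hm0
  linarith [f1, f2]

/-- **C9″b FAILS BEYOND HALF THE TORUS**: `L² < 2N ⇒ E(l,L) < N(1 − cos(π/N)) + M(1 − cos(π/M))`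
(e.g. `L = l + 1` for every `l ≥ 2`). [folklore] -/
theorem boxHeight_lt_sharp (hl : 2 ≤ l) (hlL : l + 1 ≤ L)
    (hMN : L ^ 2 < 2 * ((l + 1) * (l + 1) - 4)) :
    (boxHeight l L).toReal <
      (((l + 1) * (l + 1) - 4 : ℕ) : ℝ) * (1 - Real.cos (boxAlpha l / 2)) +
        ((L ^ 2 - ((l + 1) * (l + 1) - 4) : ℕ) : ℝ) *
          (1 - Real.cos (π / ((L ^ 2 - ((l + 1) * (l + 1) - 4) : ℕ) : ℝ))) :=
  (boxHeight_le_sectorFloor hl hlL hMN.le).trans_lt (sectorFloor_lt_sharpValue hl hlL hMN)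

/-- The smallest admissible volume `L = l + 1` lies beyond half the torus: `(l+1)² < 2N`
(`l ≥ 2`). [folklore] -/
theorem sq_succ_lt_two_boxN (hl : 2 ≤ l) : (l + 1) ^ 2 < 2 * ((l + 1) * (l + 1) - 4) := by
  have h : 9 ≤ (l + 1) * (l + 1) := by nlinarith
  rw [sq]; omega

/-- **C9″b fails at the smallest volume `L = l + 1` for every `l ≥ 2`.** [folklore] -/
theorem boxHeight_lt_sharp_minVolume (hl : 2 ≤ l) :
    (boxHeight l (l + 1)).toReal <
      (((l + 1) * (l + 1) - 4 : ℕ) : ℝ) * (1 - Real.cos (boxAlpha l / 2)) +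
        (((l + 1) ^ 2 - ((l + 1) * (l + 1) - 4) : ℕ) : ℝ) *
          (1 - Real.cos (π / (((l + 1) ^ 2 - ((l + 1) * (l + 1) - 4) : ℕ) : ℝ))) :=
  boxHeight_lt_sharp hl le_rfl (sq_succ_lt_two_boxN hl)

/-- **C9″b ⟺ the block covers at most half the torus**: `E(l,L) = N(1 − cos(π/N)) +
M(1 − cos(π/M)) ↔ 2N ≤ L²`. [folklore] -/
theorem boxHeight_eq_sharp_iff (hl : 2 ≤ l) (hlL : l + 1 ≤ L) :
    (boxHeight l L).toReal =
      (((l + 1) * (l + 1) - 4 : ℕ) : ℝ) * (1 - Real.cos (boxAlpha l / 2)) +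
        ((L ^ 2 - ((l + 1) * (l + 1) - 4) : ℕ) : ℝ) *
          (1 - Real.cos (π / ((L ^ 2 - ((l + 1) * (l + 1) - 4) : ℕ) : ℝ))) ↔
      2 * ((l + 1) * (l + 1) - 4) ≤ L ^ 2 :=
  ⟨fun h => by
    by_contra hlt
    exact (boxHeight_lt_sharp hl hlL (not_le.mp hlt)).ne h,
   boxHeight_eq_sharp hl hlL⟩

/-- **The two-regime closed form** (every `2 ≤ l`, `l + 1 ≤ L`, every parity):
`E(l,L) = if 2N ≤ L² then N(1 − cos(π/N)) + M(1 − cos(π/M)) else L²(1 − cos(2π/L²))`. [folklore] -/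
theorem boxHeight_toReal_eq_ite (hl : 2 ≤ l) (hlL : l + 1 ≤ L) :
    (boxHeight l L).toReal =
      if 2 * ((l + 1) * (l + 1) - 4) ≤ L ^ 2 then
        (((l + 1) * (l + 1) - 4 : ℕ) : ℝ) * (1 - Real.cos (boxAlpha l / 2)) +
          ((L ^ 2 - ((l + 1) * (l + 1) - 4) : ℕ) : ℝ) *
            (1 - Real.cos (π / ((L ^ 2 - ((l + 1) * (l + 1) - 4) : ℕ) : ℝ)))
      else (L : ℝ) ^ 2 * (1 - Real.cos (2 * π / (L : ℝ) ^ 2)) := by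
  split_ifs with h
  · exact boxHeight_eq_sharp hl hlL h
  · exact boxHeight_eq_sectorFloor hl hlL (by omega)

/-- **THE FIXED-VOLUME SHARP RATE, up to half the torus** (`2N ≤ L²`, every parity): for every
`ε > 0`, eventually in `β`, `e^{−β(E* + ε)} ≤ P_{β,l,L} ≤ e^{−β(E* − ε)}` with
`E* = N(1 − cos(π/N)) + M(1 − cos(π/M))`. [folklore] -/
theorem u1_boxInsertion_fixedVolume_rate_sharp (hl : 2 ≤ l) (hlL : l + 1 ≤ L)
    (hNM : 2 * ((l + 1) * (l + 1) - 4) ≤ L ^ 2) {ε : ℝ} (hε : 0 < ε) :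
    ∀ᶠ β : ℝ in atTop,
      Real.exp (-(β * ((((l + 1) * (l + 1) - 4 : ℕ) : ℝ) * (1 - Real.cos (boxAlpha l / 2)) +
          ((L ^ 2 - ((l + 1) * (l + 1) - 4) : ℕ) : ℝ) *
            (1 - Real.cos (π / ((L ^ 2 - ((l + 1) * (l + 1) - 4) : ℕ) : ℝ))) + ε))) ≤
        boxTunnelProb β l L ∧
      boxTunnelProb β l L ≤
        Real.exp (-(β * ((((l + 1) * (l + 1) - 4 : ℕ) : ℝ) * (1 - Real.cos (boxAlpha l / 2)) +
          ((L ^ 2 - ((l + 1) * (l + 1) - 4) : ℕ) : ℝ) *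
            (1 - Real.cos (π / ((L ^ 2 - ((l + 1) * (l + 1) - 4) : ℕ) : ℝ))) - ε))) := by
  rw [← boxHeight_eq_sharp hl hlL hNM]
  exact u1_boxInsertion_height_law hl hlL hε

/-- **THE FIXED-VOLUME SHARP RATE, beyond half the torus** (`L² ≤ 2N`): for every `ε > 0`,
eventually in `β`, `e^{−β(S₁ + ε)} ≤ P_{β,l,L} ≤ e^{−β(S₁ − ε)}` with `S₁ = L²(1 − cos(2π/L²))`.
[folklore] -/
theorem u1_boxInsertion_fixedVolume_rate_sectorFloor (hl : 2 ≤ l) (hlL : l + 1 ≤ L)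
    (hMN : L ^ 2 ≤ 2 * ((l + 1) * (l + 1) - 4)) {ε : ℝ} (hε : 0 < ε) :
    ∀ᶠ β : ℝ in atTop,
      Real.exp (-(β * ((L : ℝ) ^ 2 * (1 - Real.cos (2 * π / (L : ℝ) ^ 2)) + ε))) ≤
        boxTunnelProb β l L ∧
      boxTunnelProb β l L ≤
        Real.exp (-(β * ((L : ℝ) ^ 2 * (1 - Real.cos (2 * π / (L : ℝ) ^ 2)) - ε))) := by
  rw [← boxHeight_eq_sectorFloor hl hlL hMN]
  exact u1_boxInsertion_height_law hl hlL hε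

end Value

end Summit.Ventures.LatticeQCDFlow.Theory2.Lattice.Flux

end
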